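import Mathlib.LinearAlgebra.Matrix.Adjugate
import Mathlib.Analysis.Normed.Group.Constructions
import Mathlib.Analysis.Normed.Module.Basic
import Mathlib.Analysis.Normed.Lp.PiLp
import HarnessLib

/-!
# Sup-norm co-norm bounds for `3 × 3` real matrices

Topic `Algebra/EuclideanLattices`. Elementary, fully PROVED estimates for row vectors `v : Fin 3 → ℝ`
with the sup norm (Mathlib's `Pi` norm) multiplied by real `3 × 3` matrices, used to control the
integer coordinates of short vectors of a lattice given by a basis matrix `B` (if `μ ‖v‖ ≤ ‖v B‖`
for all `v` then a lattice vector `c B` of norm `≤ ρ` has coordinates `|cᵢ| ≤ ρ / μ`; this `μ`, a lower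
bound for the co-norm `‖B⁻¹‖⁻¹`, is the input of `norm_vecMul_perturb_le/ge`,
`LLLEnumerationBox.lean`):

* `abs_vecMul_apply_le`, `norm_vecMul_le_of_abs_le`: `‖v A‖ ≤ 3 α ‖v‖` if `|Aᵢⱼ| ≤ α`;
* `abs_adjugate_le`: `|adj(A)ᵢⱼ| ≤ 2 α²` (Mathlib `Matrix.adjugate_fin_three`);
* `abs_det_mul_norm_le` (**co-norm from the adjugate**): `|det A| ‖v‖ ≤ 6 α² ‖v A‖`
  (`v = (v A) adj(A) / det A`);
* `conorm_mul`, `conorm_diagonal`, `conorm_smul`: co-norm bounds multiply along products, and the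
  diagonal / scalar cases.

## References

* G. H. Golub, C. F. Van Loan, *Matrix Computations*, 4th ed., 2013, §2.3 (norm bounds,
  `‖A⁻¹‖` via the adjugate). [folklore]
-/

namespace Literature.Algebra.EuclideanLattices

open Matrix

/-! ### Upper bounds -/

/-- Each entry of `v A` is at most `3 ‖v‖ α` in absolute value when `|Aᵢⱼ| ≤ α`. [folklore] -/
theorem abs_vecMul_apply_le (v : Fin 3 → ℝ) (A : Matrix (Fin 3) (Fin 3) ℝ) {α : ℝ}
    (hA : ∀ i j, |A i j| ≤ α) (j : Fin 3) : |(v ᵥ* A) j| ≤ 3 * α * ‖v‖ := by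
  have hv : ∀ i, |v i| ≤ ‖v‖ := fun i => by
    have := norm_le_pi_norm v i
    rwa [Real.norm_eq_abs] at this
  have hα : 0 ≤ α := (abs_nonneg _).trans (hA 0 0)
  rw [Matrix.vecMul, dotProduct, Fin.sum_univ_three]
  have h0 : |v 0 * A 0 j| ≤ ‖v‖ * α := by
    rw [abs_mul]; exact mul_le_mul (hv 0) (hA 0 j) (abs_nonneg _) (norm_nonneg _)
  have h1 : |v 1 * A 1 j| ≤ ‖v‖ * α := by
    rw [abs_mul]; exact mul_le_mul (hv 1) (hA 1 j) (abs_nonneg _) (norm_nonneg _)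
  have h2 : |v 2 * A 2 j| ≤ ‖v‖ * α := by
    rw [abs_mul]; exact mul_le_mul (hv 2) (hA 2 j) (abs_nonneg _) (norm_nonneg _)
  calc |v 0 * A 0 j + v 1 * A 1 j + v 2 * A 2 j|
      ≤ |v 0 * A 0 j| + |v 1 * A 1 j| + |v 2 * A 2 j| := abs_add_three _ _ _
    _ ≤ ‖v‖ * α + ‖v‖ * α + ‖v‖ * α := add_le_add_three h0 h1 h2
    _ = 3 * α * ‖v‖ := by ring

/-- **`‖v A‖ ≤ 3 α ‖v‖`** (sup norms) when `|Aᵢⱼ| ≤ α`. [folklore] -/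
theorem norm_vecMul_le_of_abs_le (v : Fin 3 → ℝ) (A : Matrix (Fin 3) (Fin 3) ℝ) {α : ℝ}
    (hA : ∀ i j, |A i j| ≤ α) : ‖v ᵥ* A‖ ≤ 3 * α * ‖v‖ := by
  have hα : 0 ≤ α := (abs_nonneg _).trans (hA 0 0)
  rw [pi_norm_le_iff_of_nonneg (by positivity)]
  intro j
  rw [Real.norm_eq_abs]
  exact abs_vecMul_apply_le v A hA j

/-- **Entries of the adjugate**: `|adj(A)ᵢⱼ| ≤ 2 α²` when `|Aᵢⱼ| ≤ α` (each entry is a difference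
of two products of two entries, `Matrix.adjugate_fin_three`). [folklore] -/
theorem abs_adjugate_le (A : Matrix (Fin 3) (Fin 3) ℝ) {α : ℝ} (hA : ∀ i j, |A i j| ≤ α)
    (i j : Fin 3) : |A.adjugate i j| ≤ 2 * α ^ 2 := by
  have hα : 0 ≤ α := (abs_nonneg _).trans (hA 0 0)
  have hp : ∀ i j k l, |A i j * A k l| ≤ α ^ 2 := fun i j k l => by
    rw [abs_mul, pow_two]; exact mul_le_mul (hA i j) (hA k l) (abs_nonneg _) hα
  have key : ∀ i j k l i' j' k' l', |A i j * A k l - A i' j' * A k' l'| ≤ 2 * α ^ 2 :=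
    fun i j k l i' j' k' l' =>
      (abs_sub _ _).trans (by linarith [hp i j k l, hp i' j' k' l'])
  have key' : ∀ i j k l i' j' k' l', |-(A i j * A k l) + A i' j' * A k' l'| ≤ 2 * α ^ 2 :=
    fun i j k l i' j' k' l' => by
      rw [neg_add_eq_sub]; exact key _ _ _ _ _ _ _ _
  rw [Matrix.adjugate_fin_three]
  fin_cases i <;> fin_cases j
  · exact key _ _ _ _ _ _ _ _
  · exact key' _ _ _ _ _ _ _ _
  · exact key _ _ _ _ _ _ _ _
  · exact key' _ _ _ _ _ _ _ _
  · exact key _ _ _ _ _ _ _ _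
  · exact key' _ _ _ _ _ _ _ _
  · exact key _ _ _ _ _ _ _ _
  · exact key' _ _ _ _ _ _ _ _
  · exact key _ _ _ _ _ _ _ _

/-! ### Co-norm bounds -/

/-- **Co-norm from the adjugate**: `|det A| ‖v‖ ≤ 6 α² ‖v A‖` when `|Aᵢⱼ| ≤ α`, since
`(v A) adj(A) = det A • v` and `‖w adj(A)‖ ≤ 3 (2α²) ‖w‖`. Hence for `det A ≠ 0` every `v` has
`‖v‖ ≤ (6 α² / |det A|) ‖v A‖`. [folklore] -/
theorem abs_det_mul_norm_le (v : Fin 3 → ℝ) (A : Matrix (Fin 3) (Fin 3) ℝ) {α : ℝ}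
    (hA : ∀ i j, |A i j| ≤ α) : |A.det| * ‖v‖ ≤ 6 * α ^ 2 * ‖v ᵥ* A‖ := by
  have h1 : v ᵥ* A ᵥ* A.adjugate = A.det • v := by
    rw [Matrix.vecMul_vecMul, Matrix.mul_adjugate, Matrix.vecMul_smul, Matrix.vecMul_one]
  have h2 : ‖A.det • v‖ = |A.det| * ‖v‖ := by rw [norm_smul, Real.norm_eq_abs]
  have h3 := norm_vecMul_le_of_abs_le (v ᵥ* A) A.adjugate (abs_adjugate_le A hA)
  rw [h1, h2] at h3
  linarith

/-- **Co-norm bounds multiply**: if `μ₁ ‖v‖ ≤ ‖v A‖` and `μ₂ ‖w‖ ≤ ‖w B‖` for all `v, w`, with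
`μ₂ ≥ 0`, then `μ₁ μ₂ ‖v‖ ≤ ‖v (A B)‖`. [folklore] -/
theorem conorm_mul {m n o : Type*} [Fintype m] [Fintype n] [Fintype o]
    (A : Matrix m n ℝ) (B : Matrix n o ℝ) {μ₁ μ₂ : ℝ} (hμ₂ : 0 ≤ μ₂)
    (hA : ∀ v : m → ℝ, μ₁ * ‖v‖ ≤ ‖v ᵥ* A‖) (hB : ∀ w : n → ℝ, μ₂ * ‖w‖ ≤ ‖w ᵥ* B‖)
    (v : m → ℝ) : μ₁ * μ₂ * ‖v‖ ≤ ‖v ᵥ* (A * B)‖ := by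
  rw [← Matrix.vecMul_vecMul]
  calc μ₁ * μ₂ * ‖v‖ = μ₂ * (μ₁ * ‖v‖) := by ring
    _ ≤ μ₂ * ‖v ᵥ* A‖ := mul_le_mul_of_nonneg_left (hA v) hμ₂
    _ ≤ ‖v ᵥ* A ᵥ* B‖ := hB _

/-- **Co-norm of a diagonal matrix**: if `0 ≤ μ ≤ |dᵢ|` for all `i` then `μ ‖v‖ ≤ ‖v · diag(d)‖`.
[folklore] -/
theorem conorm_diagonal {m : Type*} [Fintype m] [DecidableEq m] (d : m → ℝ) {μ : ℝ} (hμ : 0 ≤ μ)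
    (hd : ∀ i, μ ≤ |d i|) (v : m → ℝ) : μ * ‖v‖ ≤ ‖v ᵥ* Matrix.diagonal d‖ := by
  have key : ∀ i, μ * ‖v i‖ ≤ ‖v ᵥ* Matrix.diagonal d‖ := fun i => by
    calc μ * ‖v i‖ ≤ |d i| * ‖v i‖ := mul_le_mul_of_nonneg_right (hd i) (norm_nonneg _)
      _ = ‖(v ᵥ* Matrix.diagonal d) i‖ := by
          rw [Matrix.vecMul_diagonal, norm_mul, Real.norm_eq_abs, Real.norm_eq_abs, mul_comm]
      _ ≤ ‖v ᵥ* Matrix.diagonal d‖ := norm_le_pi_norm _ i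
  rcases isEmpty_or_nonempty m with hm | hm
  · simp [Subsingleton.elim v 0]
  obtain ⟨i, -, hi⟩ := Finset.exists_max_image Finset.univ (fun i => ‖v i‖) Finset.univ_nonempty
  have hvi : ‖v‖ ≤ ‖v i‖ := (pi_norm_le_iff_of_nonneg (norm_nonneg _)).2 fun j => hi j (Finset.mem_univ j)
  exact (mul_le_mul_of_nonneg_left hvi hμ).trans (key i)

/-- **Co-norm of a scalar multiple**: `μ ‖v‖ ≤ ‖v A‖` for all `v` gives
`(|r| μ) ‖v‖ ≤ ‖v (r • A)‖`. [folklore] -/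
theorem conorm_smul {m n : Type*} [Fintype m] [Fintype n] (A : Matrix m n ℝ) (r : ℝ) {μ : ℝ}
    (hA : ∀ v : m → ℝ, μ * ‖v‖ ≤ ‖v ᵥ* A‖) (v : m → ℝ) : |r| * μ * ‖v‖ ≤ ‖v ᵥ* (r • A)‖ := by
  rw [Matrix.vecMul_smul, norm_smul, Real.norm_eq_abs, mul_assoc]
  exact mul_le_mul_of_nonneg_left (hA v) (abs_nonneg r)

/-- **The co-norm of a `3 × 3` matrix with bounded entries and nonzero determinant**, in the form
consumed downstream: `(|det A| / (6 α²)) ‖v‖ ≤ ‖v A‖`. [folklore] -/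
theorem conorm_of_abs_le (A : Matrix (Fin 3) (Fin 3) ℝ) {α : ℝ} (hα : 0 < α)
    (hA : ∀ i j, |A i j| ≤ α) (v : Fin 3 → ℝ) : |A.det| / (6 * α ^ 2) * ‖v‖ ≤ ‖v ᵥ* A‖ := by
  have h := abs_det_mul_norm_le v A hA
  have h6 : (0 : ℝ) < 6 * α ^ 2 := by positivity
  rw [div_mul_eq_mul_div, div_le_iff₀ h6]
  linarith

end Literature.Algebra.EuclideanLattices
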